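import Summits.QuantumAdvantage.QuantumAdvantage.Theorems.SymplecticPurityDeqThesisCoreRealPairs
import Summits.QuantumAdvantage.QuantumAdvantage.Theorems.SymplecticPurityDeqThesisProductWeight

/-!
# Crux `DeqThesis`, line `Sketch` — real-tilt core, file 3/4: the Fourier bound

`J_fourier_bound`: `|J d| ≤ 4√2ⁿ ∏_{out} max(|c|,|s|)` for `d ≠ 0`, from the product-weight Fourier inversion
(`productWeight_eq_walsh_sum`, `sum_abs_walshProductWeight`) and a Gold-type quadratic Walsh bound supplied as the
hypothesis `hgold` (discharged in file 4 by `GoldWalsh.abs_walsh_gold_add_le`): in trace-orthonormal coordinates the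
pair phase along `d` is `φ(u) + Tr((a'+α³)u³ + αu⁵) + κ` with `φ` additive (`inner_sum_bound`). Also `am_le`:
`(|c|+|s|)max(|c|,|s|) ≤ (1+√2)/2`. Registered alias: `stub_coreRealFourier`.
-/

set_option linter.dupNamespace false -- D-0017: single-problem summit ⇒ `QuantumAdvantage.QuantumAdvantage` by design

noncomputable section

namespace Summit.QuantumAdvantage.QuantumAdvantage.Theorems.SymplecticPurity

open Matrix Finset
open Literature.Computability.QuantumComplexity Literature.Computability.Cryptography

namespace CoreReal

variable {n : ℕ}

section Statements

variable {K : Type} [Field K] [Fintype K] [Algebra (ZMod 2) K]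

/-! ### The Fourier bound -/

omit [Fintype K] [Algebra (ZMod 2) K] in
/-- The full bilinear character `(−1)^{t·v}`. -/
def sgnFull (t v : Fin n → Bool) : ℝ := ∏ j, (if (t j && v j) then (-1 : ℝ) else 1)

omit [Fintype K] [Algebra (ZMod 2) K] in
/-- Replacing the support-restricted sign by the full bilinear character under the weight:
`pw S t · sgn S t v = pw S t · (sgn S 0 v · sgnFull t v)`. -/
theorem pw_mul_sgn_eq (S : Finset (Fin n)) (c s : Fin n → ℝ) (t v : Fin n → Bool) :
    pw S c s t * sgn S t v = pw S c s t * (sgn S (fun _ => false) v * sgnFull t v) := by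
  classical
  by_cases ht : ∀ j, t j = true → j ∈ S
  · congr 1
    rw [sgn, sgn, sgnFull, ← Finset.prod_mul_distrib]
    refine Finset.prod_congr rfl fun j _ => ?_
    by_cases hj : j ∈ S
    · cases htj : t j <;> cases v j <;> simp [hj]
    · have htj : t j = false := by
        cases h : t j
        · rfl
        · exact absurd (ht j h) hj
      cases v j <;> simp [hj, htj]
  · push Not at ht
    obtain ⟨j, htj, hj⟩ := ht
    have h0 : pw S c s t = 0 := by
      rw [pw]
      exact Finset.prod_eq_zero (Finset.mem_univ j) (by simp [hj, htj])
    rw [h0, zero_mul, zero_mul]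

omit [Fintype K] [Algebra (ZMod 2) K] in
/-- `pw` as a plain product weight with modified parameters (`c = 1`, `s = 0` off the support). -/
theorem pw_eq_prod (S : Finset (Fin n)) (c s : Fin n → ℝ) (t : Fin n → Bool) :
    pw S c s t = ∏ j, (if t j then (if j ∈ S then s j else 0) else (if j ∈ S then c j else 1)) := by
  rw [pw]
  refine Finset.prod_congr rfl fun j _ => ?_
  by_cases hj : j ∈ S <;> cases t j <;> simp [hj]

omit [Fintype K] [Algebra (ZMod 2) K] in
/-- PRODUCT-WEIGHT FOURIER INVERSION (landed `productWeight_eq_walsh_sum`). -/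
theorem pw_fourier (S : Finset (Fin n)) (c s : Fin n → ℝ) (t : Fin n → Bool) :
    pw S c s t = (2 : ℝ)⁻¹ ^ n * ∑ b : Fin n → Bool,
      (∏ j, ((if j ∈ S then c j else 1) + (if b j then -(if j ∈ S then s j else 0) else (if j ∈ S then s j else 0)))) *
        sgnFull b t := by
  rw [pw_eq_prod]
  exact productWeight_eq_walsh_sum n (fun j => if j ∈ S then c j else 1) (fun j => if j ∈ S then s j else 0) t

omit [Fintype K] [Algebra (ZMod 2) K] in
/-- PRODUCT-WEIGHT FOURIER MASS (landed `sum_abs_walshProductWeight`). -/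
theorem sum_abs_hat_pw (S : Finset (Fin n)) (c s : Fin n → ℝ) :
    ∑ b : Fin n → Bool,
      |∏ j, ((if j ∈ S then c j else 1) + (if b j then -(if j ∈ S then s j else 0) else (if j ∈ S then s j else 0)))| =
      ∏ j, (|(if j ∈ S then c j else 1) + (if j ∈ S then s j else 0)| +
        |(if j ∈ S then c j else 1) - (if j ∈ S then s j else 0)|) :=
  sum_abs_walshProductWeight n (fun j => if j ∈ S then c j else 1) (fun j => if j ∈ S then s j else 0)

omit [Fintype K] [Algebra (ZMod 2) K] in
/-- `|c+s| + |c−s| = 2 max(|c|,|s|)`. -/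
theorem abs_add_add_abs_sub (c s : ℝ) : |c + s| + |c - s| = 2 * max |c| |s| := by
  rcases le_total 0 (c + s) with h1 | h1 <;> rcases le_total 0 (c - s) with h2 | h2 <;>
    rcases le_total 0 c with h3 | h3 <;> rcases le_total 0 s with h4 | h4 <;>
    simp only [abs_of_nonneg, abs_of_nonpos, h1, h2, h3, h4, max_def] <;>
    split_ifs <;> linarith

omit [Fintype K] [Algebra (ZMod 2) K] in
/-- The Fourier mass of the output weight: `2ⁿ ∏_{S} max(|c|,|s|)`. -/
theorem sum_abs_hat_pw_eq (S : Finset (Fin n)) (c s : Fin n → ℝ) :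
    ∑ b : Fin n → Bool,
      |∏ j, ((if j ∈ S then c j else 1) + (if b j then -(if j ∈ S then s j else 0) else (if j ∈ S then s j else 0)))| =
      2 ^ n * ∏ j ∈ S, max |c j| |s j| := by
  classical
  rw [sum_abs_hat_pw]
  have hsite : ∀ j, |(if j ∈ S then c j else 1) + (if j ∈ S then s j else 0)| +
      |(if j ∈ S then c j else 1) - (if j ∈ S then s j else 0)| = 2 * (if j ∈ S then max |c j| |s j| else 1) := by
    intro j
    by_cases hj : j ∈ S
    · simp only [hj, if_true, abs_add_add_abs_sub]
    · simp [hj]; norm_num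
  simp_rw [hsite]
  rw [Finset.prod_mul_distrib, Finset.prod_const, Finset.card_univ, Fintype.card_fin, Finset.prod_ite,
    Finset.prod_const_one, mul_one, Finset.filter_mem_eq_inter, Finset.univ_inter]

omit [Fintype K] [Algebra (ZMod 2) K] in
/-- The bilinear character through the coordinates: `sgnFull (bits x) (bits w) = χ(Σ_j [x]ⱼ[w]ⱼ)`. -/
theorem sgnFull_bits (e : K ≃+ (Fin n → ZMod 2)) (x w : K) :
    sgnFull (bits e x) (bits e w) = if ∑ j, e x j * e w j = 0 then (1 : ℝ) else -1 := by
  rw [← prod_sign_eq, sgnFull]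
  refine Finset.prod_congr rfl fun j _ => ?_
  simp only [bits]
  rcases zmod_two_eq_zero_or_eq_one (e x j) with h1 | h1 <;>
    rcases zmod_two_eq_zero_or_eq_one (e w j) with h2 | h2 <;> simp [h1, h2]

omit [Fintype K] [Algebra (ZMod 2) K] in
/-- The field element whose coordinates are the indicator of `S`. -/
def indK (e : K ≃+ (Fin n → ZMod 2)) (S : Finset (Fin n)) : K := e.symm fun i => if i ∈ S then 1 else 0

omit [Fintype K] in
/-- Under trace-orthonormality the coordinate sum is a trace: `Σ_{i∈S}[w]ᵢ = Tr(indK S · w)`. -/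
theorem coordSum_eq_trace (e : K ≃+ (Fin n → ZMod 2))
    (hsd : ∀ x y : K, ∑ i, e x i * e y i = Algebra.trace (ZMod 2) K (x * y)) (S : Finset (Fin n)) (w : K) :
    coordSum e S w = Algebra.trace (ZMod 2) K (indK e S * w) := by
  classical
  rw [← hsd, coordSum_apply, indK, AddEquiv.apply_symm_apply]
  rw [← Finset.sum_filter_add_sum_filter_not Finset.univ (fun i => i ∈ S)]
  rw [Finset.filter_mem_eq_inter, Finset.univ_inter]
  have h0 : ∑ i ∈ Finset.univ.filter (fun i => i ∉ S), (if i ∈ S then (1 : ZMod 2) else 0) * e w i = 0 :=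
    Finset.sum_eq_zero fun i hi => by rw [Finset.mem_filter] at hi; simp [hi.2]
  rw [h0, add_zero]
  exact Finset.sum_congr rfl fun i hi => by simp [hi]

/-- The inner character sums are Gold-type quadratic Walsh sums: for `d ≠ 0` and any `b`,
`|Σ_y sgnIn y · sgnOut⁰(F y) · sgnFull (T y) (F y) · sgnFull b (T y)| ≤ 4√2ⁿ`. -/
theorem inner_sum_bound (hK : Fintype.card K = 2 ^ n) (e : K ≃+ (Fin n → ZMod 2))
    (hsd : ∀ x y : K, ∑ i, e x i * e y i = Algebra.trace (ZMod 2) K (x * y))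
    (Sin Sout : Finset (Fin n)) (d : Fin n → Bool) (hd : d ≠ fun _ => false) (b : Fin n → Bool)
    (hgold : ∀ {β : K}, β ≠ 0 → ∀ (α : K) (φ : K →+ ZMod 2),
      |∑ x : K, (if φ x + Algebra.trace (ZMod 2) K (α * x ^ 3 + β * x ^ 5) = 0 then (1 : ℝ) else -1)|
        ≤ 4 * Real.sqrt 2 ^ n) :
    |∑ y : Fin n → Bool, sgn Sin d y * sgn Sout (fun _ => false) (cubeCoords e y) *
        sgnFull (T e d y) (cubeCoords e y) * sgnFull b (T e d y)| ≤ 4 * Real.sqrt 2 ^ n := by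
  classical
  haveI : CharP K 2 := CubeAlmostBent.charP_two_of_algebra
  have h2 : (2 : K) = 0 := two_eq_zero_of_card hK
  set α : K := toK e d with hα
  have hα0 : α ≠ 0 := toK_ne_zero e hd
  set βt : K := toK e b with hβt
  set a' : K := indK e Sout with ha'
  -- the additive part of the pair phase
  have hsq : ∀ u v : K, (u + v) ^ 2 = u ^ 2 + v ^ 2 := fun u v => by linear_combination (u * v) * h2
  have hp4 : ∀ u v : K, (u + v) ^ 4 = u ^ 4 + v ^ 4 := fun u v => by
    rw [show (4 : ℕ) = 2 * 2 from rfl, pow_mul, pow_mul, pow_mul, hsq, hsq]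
  let φ : K →+ ZMod 2 :=
    coordSum e (Sin.filter fun i => d i = false) +
      AddMonoidHom.mk' (fun u => Algebra.trace (ZMod 2) K (α ^ 2 * u ^ 4 + βt * α * u ^ 2 + βt * α ^ 2 * u))
        (fun u v => by rw [← map_add]; congr 1; rw [hp4, hsq]; ring)
  have hφ : ∀ u, φ u = coordSum e (Sin.filter fun i => d i = false) u +
      Algebra.trace (ZMod 2) K (α ^ 2 * u ^ 4 + βt * α * u ^ 2 + βt * α ^ 2 * u) := fun u => rfl
  -- the constant
  set κ : ZMod 2 := Algebra.trace (ZMod 2) K (βt * α ^ 3) with hκ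
  -- pointwise identification of the summand with `χ(φ u + Tr((a'+α³)u³ + αu⁵)) · χ(κ)`
  have hpt : ∀ u : K,
      sgn Sin d (bits e u) * sgn Sout (fun _ => false) (cubeCoords e (bits e u)) *
        sgnFull (T e d (bits e u)) (cubeCoords e (bits e u)) * sgnFull b (T e d (bits e u)) =
      (if φ u + Algebra.trace (ZMod 2) K ((a' + α ^ 3) * u ^ 3 + α * u ^ 5) = 0 then (1 : ℝ) else -1) *
        (if κ = 0 then (1 : ℝ) else -1) := by
    intro u
    have hF : cubeCoords e (bits e u) = bits e (u ^ 3) := by rw [cubeCoords_eq_bits, toK_bits]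
    have hT : T e d (bits e u) = bits e ((u + α) ^ 3 + u ^ 3) := by rw [T_eq_bits, toK_bits]
    have hb : b = bits e βt := by rw [hβt, bits_toK]
    have hfilter : Sout.filter (fun i => (false : Bool) = false) = Sout :=
      Finset.filter_true_of_mem fun _ _ => rfl
    -- the four sign factors as characters
    have h1 : sgn Sin d (bits e u) =
        if coordSum e (Sin.filter fun i => d i = false) u = 0 then (1 : ℝ) else -1 := sgn_bits_eq e Sin d u
    have h2' : sgn Sout (fun _ => false) (cubeCoords e (bits e u)) =
        if coordSum e Sout (u ^ 3) = 0 then (1 : ℝ) else -1 := by rw [hF, sgn_bits_eq, hfilter]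
    have h3 : sgnFull (T e d (bits e u)) (cubeCoords e (bits e u)) =
        if Algebra.trace (ZMod 2) K (((u + α) ^ 3 + u ^ 3) * u ^ 3) = 0 then (1 : ℝ) else -1 := by
      rw [hT, hF, sgnFull_bits, hsd]
    have h4 : sgnFull b (T e d (bits e u)) =
        if Algebra.trace (ZMod 2) K (βt * ((u + α) ^ 3 + u ^ 3)) = 0 then (1 : ℝ) else -1 := by
      rw [hT, hb, sgnFull_bits, hsd]
    rw [h1, h2', h3, h4, sign_mul_sign, sign_mul_sign, sign_mul_sign, sign_mul_sign]
    -- the `ZMod 2` bookkeeping of the exponent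
    have hABC : a' * u ^ 3 + ((u + α) ^ 3 + u ^ 3) * u ^ 3 + βt * ((u + α) ^ 3 + u ^ 3) =
        (α ^ 2 * u ^ 4 + βt * α * u ^ 2 + βt * α ^ 2 * u) + ((a' + α ^ 3) * u ^ 3 + α * u ^ 5) + βt * α ^ 3 := by
      linear_combination (u ^ 6 + α * u ^ 5 + α ^ 2 * u ^ 4 + βt * u ^ 3 + βt * α * u ^ 2 + βt * α ^ 2 * u) * h2
    have key : coordSum e (Sin.filter fun i => d i = false) u + coordSum e Sout (u ^ 3) +
          Algebra.trace (ZMod 2) K (((u + α) ^ 3 + u ^ 3) * u ^ 3) +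
          Algebra.trace (ZMod 2) K (βt * ((u + α) ^ 3 + u ^ 3)) =
        φ u + Algebra.trace (ZMod 2) K ((a' + α ^ 3) * u ^ 3 + α * u ^ 5) + κ := by
      rw [coordSum_eq_trace e hsd Sout (u ^ 3), ← ha', hφ, hκ]
      calc coordSum e (Sin.filter fun i => d i = false) u + Algebra.trace (ZMod 2) K (a' * u ^ 3) +
            Algebra.trace (ZMod 2) K (((u + α) ^ 3 + u ^ 3) * u ^ 3) +
            Algebra.trace (ZMod 2) K (βt * ((u + α) ^ 3 + u ^ 3))
          = coordSum e (Sin.filter fun i => d i = false) u +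
              Algebra.trace (ZMod 2) K (a' * u ^ 3 + ((u + α) ^ 3 + u ^ 3) * u ^ 3 + βt * ((u + α) ^ 3 + u ^ 3)) := by
            rw [map_add, map_add]; ring
        _ = coordSum e (Sin.filter fun i => d i = false) u +
              Algebra.trace (ZMod 2) K ((α ^ 2 * u ^ 4 + βt * α * u ^ 2 + βt * α ^ 2 * u) +
                ((a' + α ^ 3) * u ^ 3 + α * u ^ 5) + βt * α ^ 3) := by rw [hABC]
        _ = _ := by rw [map_add, map_add]; ring
    rw [key]
  -- reindex over the field and apply the Gold-type bound
  rw [← Equiv.sum_comp (bitsEquiv e).symm]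
  have hu : ∀ u, (bitsEquiv e).symm u = bits e u := fun _ => rfl
  simp_rw [hu, hpt]
  rw [← Finset.sum_mul, abs_mul]
  have hκ1 : |(if κ = 0 then (1 : ℝ) else -1)| ≤ 1 := by split_ifs <;> simp
  calc |∑ u : K, (if φ u + Algebra.trace (ZMod 2) K ((a' + α ^ 3) * u ^ 3 + α * u ^ 5) = 0 then (1 : ℝ) else -1)| *
        |(if κ = 0 then (1 : ℝ) else -1)|
      ≤ 4 * Real.sqrt 2 ^ n * 1 :=
        mul_le_mul (hgold hα0 (a' + α ^ 3) φ) hκ1 (abs_nonneg _) (by positivity)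
    _ = 4 * Real.sqrt 2 ^ n := mul_one _

/-- FOURIER BOUND on `J d`, `d ≠ 0` (trace-orthonormal `e`; Gold-type Walsh bound supplied as `hgold`). -/
theorem J_fourier_bound (hK : Fintype.card K = 2 ^ n) (e : K ≃+ (Fin n → ZMod 2))
    (hsd : ∀ x y : K, ∑ i, e x i * e y i = Algebra.trace (ZMod 2) K (x * y))
    (hgold : ∀ {β : K}, β ≠ 0 → ∀ (α : K) (φ : K →+ ZMod 2),
      |∑ x : K, (if φ x + Algebra.trace (ZMod 2) K (α * x ^ 3 + β * x ^ 5) = 0 then (1 : ℝ) else -1)|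
        ≤ 4 * Real.sqrt 2 ^ n)
    (A : Finset (Fin (n + n))) (c s : Fin (n + n) → ℝ) (d : Fin n → Bool) (hd : d ≠ fun _ => false) :
    |J e A c s d| ≤ 4 * Real.sqrt 2 ^ n * ∏ j ∈ outSupp A, max |c (Fin.natAdd n j)| |s (Fin.natAdd n j)| := by
  classical
  set c' : Fin n → ℝ := fun j => c (Fin.natAdd n j) with hc'
  set s' : Fin n → ℝ := fun j => s (Fin.natAdd n j) with hs'
  set S := outSupp A with hS
  set inner : (Fin n → Bool) → ℝ := fun b => ∑ y : Fin n → Bool,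
    sgn (inSupp A) d y * sgn S (fun _ => false) (cubeCoords e y) * sgnFull (T e d y) (cubeCoords e y) *
      sgnFull b (T e d y) with hinner
  -- expand `J` along the Fourier inversion of the output weight
  have hJ : J e A c s d = (2 : ℝ)⁻¹ ^ n * ∑ b : Fin n → Bool,
      (∏ j, ((if j ∈ S then c' j else 1) +
        (if b j then -(if j ∈ S then s' j else 0) else (if j ∈ S then s' j else 0)))) * inner b := by
    have step : ∀ y : Fin n → Bool,
        sgn (inSupp A) d y * (pw S c' s' (T e d y) * sgn S (T e d y) (cubeCoords e y)) =
        ∑ b : Fin n → Bool, (2 : ℝ)⁻¹ ^ n *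
          ((∏ j, ((if j ∈ S then c' j else 1) +
            (if b j then -(if j ∈ S then s' j else 0) else (if j ∈ S then s' j else 0)))) *
          (sgn (inSupp A) d y * sgn S (fun _ => false) (cubeCoords e y) *
            sgnFull (T e d y) (cubeCoords e y) * sgnFull b (T e d y))) := by
      intro y
      rw [pw_mul_sgn_eq, pw_fourier S c' s' (T e d y)]
      simp only [Finset.mul_sum, Finset.sum_mul]
      refine Finset.sum_congr rfl fun b _ => ?_
      ring
    calc J e A c s d
        = ∑ y : Fin n → Bool, sgn (inSupp A) d y * (pw S c' s' (T e d y) * sgn S (T e d y) (cubeCoords e y)) := rfl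
      _ = ∑ y : Fin n → Bool, ∑ b : Fin n → Bool, (2 : ℝ)⁻¹ ^ n *
          ((∏ j, ((if j ∈ S then c' j else 1) +
            (if b j then -(if j ∈ S then s' j else 0) else (if j ∈ S then s' j else 0)))) *
          (sgn (inSupp A) d y * sgn S (fun _ => false) (cubeCoords e y) *
            sgnFull (T e d y) (cubeCoords e y) * sgnFull b (T e d y))) := Finset.sum_congr rfl fun y _ => step y
      _ = _ := by
          rw [Finset.sum_comm, Finset.mul_sum]
          refine Finset.sum_congr rfl fun b _ => ?_
          rw [hinner, Finset.mul_sum, Finset.mul_sum]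
  rw [hJ, abs_mul, abs_of_nonneg (by positivity : (0 : ℝ) ≤ (2 : ℝ)⁻¹ ^ n)]
  have hsum : |∑ b : Fin n → Bool,
      (∏ j, ((if j ∈ S then c' j else 1) +
        (if b j then -(if j ∈ S then s' j else 0) else (if j ∈ S then s' j else 0)))) * inner b| ≤
      (2 ^ n * ∏ j ∈ S, max |c' j| |s' j|) * (4 * Real.sqrt 2 ^ n) := by
    calc |∑ b : Fin n → Bool, (∏ j, ((if j ∈ S then c' j else 1) +
            (if b j then -(if j ∈ S then s' j else 0) else (if j ∈ S then s' j else 0)))) * inner b|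
        ≤ ∑ b : Fin n → Bool, |(∏ j, ((if j ∈ S then c' j else 1) +
            (if b j then -(if j ∈ S then s' j else 0) else (if j ∈ S then s' j else 0)))) * inner b| :=
          Finset.abs_sum_le_sum_abs _ _
      _ ≤ ∑ b : Fin n → Bool, |∏ j, ((if j ∈ S then c' j else 1) +
            (if b j then -(if j ∈ S then s' j else 0) else (if j ∈ S then s' j else 0)))| *
            (4 * Real.sqrt 2 ^ n) := by
          refine Finset.sum_le_sum fun b _ => ?_
          rw [abs_mul]
          exact mul_le_mul_of_nonneg_left (inner_sum_bound hK e hsd (inSupp A) S d hd b hgold) (abs_nonneg _)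
      _ = (∑ b : Fin n → Bool, |∏ j, ((if j ∈ S then c' j else 1) +
            (if b j then -(if j ∈ S then s' j else 0) else (if j ∈ S then s' j else 0)))|) *
            (4 * Real.sqrt 2 ^ n) := (Finset.sum_mul _ _ _).symm
      _ = (2 ^ n * ∏ j ∈ S, max |c' j| |s' j|) * (4 * Real.sqrt 2 ^ n) := by
          rw [sum_abs_hat_pw_eq S c' s']
  calc (2 : ℝ)⁻¹ ^ n * |∑ b : Fin n → Bool, (∏ j, ((if j ∈ S then c' j else 1) +
          (if b j then -(if j ∈ S then s' j else 0) else (if j ∈ S then s' j else 0)))) * inner b|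
      ≤ (2 : ℝ)⁻¹ ^ n * ((2 ^ n * ∏ j ∈ S, max |c' j| |s' j|) * (4 * Real.sqrt 2 ^ n)) :=
        mul_le_mul_of_nonneg_left hsum (by positivity)
    _ = 4 * Real.sqrt 2 ^ n * ∏ j ∈ S, max |c' j| |s' j| := by
        have h22 : (2 : ℝ)⁻¹ ^ n * 2 ^ n = 1 := by rw [← mul_pow]; norm_num
        calc (2 : ℝ)⁻¹ ^ n * ((2 ^ n * ∏ j ∈ S, max |c' j| |s' j|) * (4 * Real.sqrt 2 ^ n))
            = ((2 : ℝ)⁻¹ ^ n * 2 ^ n) * (4 * Real.sqrt 2 ^ n * ∏ j ∈ S, max |c' j| |s' j|) := by ring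
          _ = _ := by rw [h22, one_mul]

omit [Fintype K] [Algebra (ZMod 2) K] in
/-- The per-site constant: `(|c|+|s|)·max(|c|,|s|) ≤ (1+√2)/2` on the unit circle. -/
theorem am_le (c s : ℝ) (h : c ^ 2 + s ^ 2 = 1) : (|c| + |s|) * max |c| |s| ≤ (1 + Real.sqrt 2) / 2 := by
  have h2 : Real.sqrt 2 ^ 2 = 2 := Real.sq_sqrt (by norm_num)
  have hs2 : (1 : ℝ) ≤ Real.sqrt 2 := by
    rw [show (1 : ℝ) = Real.sqrt 1 from Real.sqrt_one.symm]
    exact Real.sqrt_le_sqrt (by norm_num)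
  -- one-sided claim: `(|a| + |b|)·|a| ≤ (1+√2)/2` whenever `a² + b² = 1`
  have key : ∀ a b : ℝ, a ^ 2 + b ^ 2 = 1 → (|a| + |b|) * |a| ≤ (1 + Real.sqrt 2) / 2 := by
    intro a b hab
    have ha2 : |a| ^ 2 = a ^ 2 := sq_abs a
    have hb2 : |b| ^ 2 = b ^ 2 := sq_abs b
    have hu1 : a ^ 2 ≤ 1 := by nlinarith [sq_nonneg b]
    set k : ℝ := (1 + Real.sqrt 2) / 2 with hk
    have hku : 0 ≤ k - a ^ 2 := by rw [hk]; nlinarith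
    -- `(k - a²)² - a²(1 - a²) = 2 (a² - (2+√2)/4)²`
    have hsos : (|a| * |b|) ^ 2 ≤ (k - a ^ 2) ^ 2 := by
      have hprod : (|a| * |b|) ^ 2 = a ^ 2 * (1 - a ^ 2) := by
        rw [mul_pow, ha2, hb2]; nlinarith
      rw [hprod, hk]
      nlinarith [sq_nonneg (a ^ 2 - (2 + Real.sqrt 2) / 4), h2]
    have hab' : |a| * |b| ≤ k - a ^ 2 := (abs_le_of_sq_le_sq' hsos hku).2
    calc (|a| + |b|) * |a| = |a| ^ 2 + |a| * |b| := by ring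
      _ ≤ a ^ 2 + (k - a ^ 2) := by rw [ha2]; linarith
      _ = k := by ring
  have hc : (|c| + |s|) * |c| ≤ (1 + Real.sqrt 2) / 2 := key c s h
  have hs : (|c| + |s|) * |s| ≤ (1 + Real.sqrt 2) / 2 := by
    have := key s c (by linarith)
    linarith [this]
  rcases le_total |c| |s| with hle | hle
  · rw [max_eq_right hle]; exact hs
  · rw [max_eq_left hle]; exact hc


end Statements

end CoreReal

/-- Registered alias (file 3/4 of the real-tilt core): the Fourier bound on the pair sum. -/
theorem stub_coreRealFourier : ∀ {n : ℕ} {K : Type} [Field K] [Fintype K] [Algebra (ZMod 2) K], Fintype.card K = 2 ^ n → ∀ (e : K ≃+ (Fin n → ZMod 2)), (∀ x y : K, ∑ i, e x i * e y i = Algebra.trace (ZMod 2) K (x * y)) → (∀ {β : K}, β ≠ 0 → ∀ (α : K) (φ : K →+ ZMod 2), |∑ x : K, (if φ x + Algebra.trace (ZMod 2) K (α * x ^ 3 + β * x ^ 5) = 0 then (1 : ℝ) else -1)| ≤ 4 * Real.sqrt 2 ^ n) → ∀ (A : Finset (Fin (n + n))) (c s : Fin (n + n) → ℝ) (d : Fin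 n → Bool), d ≠ (fun _ => false) → |Summit.QuantumAdvantage.QuantumAdvantage.Theorems.SymplecticPurity.CoreReal.J e A c s d| ≤ 4 * Real.sqrt 2 ^ n * ∏ j ∈ Summit.QuantumAdvantage.QuantumAdvantage.Theorems.SymplecticPurity.CoreReal.outSupp A, max |c (Fin.natAdd n j)| |s (Fin.natAdd n j)| :=
  fun hK e hsd hgold A c s d hd => CoreReal.J_fourier_bound hK e hsd hgold A c s d hd

end Summit.QuantumAdvantage.QuantumAdvantage.Theorems.SymplecticPurity

end
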